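/-
Copyright (c) 2026 the pub-hodgecm-mathlib formalisation cell (harness21).  Prover seat hodgecm-mathlib-K2Liu-p01 (g8), Track B «K2-LIT»,
#184♮ = hLiu418 = `stmt-HodgeConjecture-24832`; #42S organ S1 ROAD W, witness TOP FILE part (W1-b) (RECIPE-F7-InertWitnessTopFile 80571dd96a2cf31d §C):
the `hphase` letter of ★∕📤 (W1-a) `K2LiuWitnessInvarianceAtTensorDatum` DISCHARGED from the boxes — `½⟨x, c_t x⟩ ∈ 𝔭^{a+b−v(d)}` when `H_t ∈ ball_a` and the frame Gram of
`b = κ₀x` is hermitian in `ball_b` — at the CM tensor datum (★ (T3a) + ★ (Φ8) + ★ `mul_mem_primePowBall_iff`).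
-/
import Summits.HodgeConjecture.HodgeConjecture.Theorems.K2LiuSiegelUnipotentPairingGram   -- ★ (T3a) `dotProduct_cOfFix_tensorEmbLoc_nElem_eq_im_trace`
import Summits.HodgeConjecture.HodgeConjecture.Theorems.K2LiuWitnessPhaseBound           -- ★ (Φ8) `d_mul_half_pairing_mem_primePowBall`
import Literature.RepresentationTheory.HeisenbergGroup.SchrodingerPiOperators            -- ★ `halfForm_apply`
import HarnessLib

/-!
# Crux `HLiu418`, #42S-S1 ROAD W, (W1-b): THE PHASE OF THE WITNESS ON A BOX — `½⟨x, c_t x⟩ ∈ 𝔭_v^{a+b−v(d)}`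

Cell `hodgecm-mathlib`, crux item hLiu418 = `stmt-HodgeConjecture-24832` (helper lane `--supports … --as helper`, count-neutral).  THEOREMS ONLY (no `def`, no instance,
no notation, no named-fact hypothesis, no `sorry`).  PLACE-GENERIC CM tensor currency `(L e dV hdV dW hdW eW e′ dV′ hdV′ v)` of ★ (T3a) §3.

THE CHAIN (SPEC-F7-PhaseChain (Φ1)(Φ4)(Φ8)).  `halfForm c x = ½·(x ⬝ᵥ c x)` (★ `halfForm_apply`); ★ (T3a) `dotProduct_cOfFix_tensorEmbLoc_nElem_eq_im_trace`:
`x ⬝ᵥ c_t x = im_Q(2·tr(𝕋₀ t G̃(x)))` with `G̃(x) j i = Σ_{k,l} b_{jl}(𝕋_{V′})_{kl}σ(b_{ik})`, `b = halfDiff(eD⁻¹E′⁻¹(x,0))`; ★ (Φ8) `d_mul_half_pairing_mem_primePowBall`: `d·½y ∈ 𝔭^{a+b}` for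
`H_t = δ̂•(𝕋₀t) ∈ ball_a` (the t-box ★ (B), `e₂ = 0`) and `G̃ ∈ ball_b` hermitian; ★ `mul_mem_primePowBall_iff` divides by `d = δ²` (`‖d‖ = q^{−v(d)}`).
* **`halfForm_mem_primePowBall_of_boxes`** — the statement (`hphase` of (W1-a) with `mψ := a + b − v(d)`, i.e. `a := c₀ = mψ + v(d)` at `b = 0`).
The hermitian-ness and the ball bound of `G̃(x)` on the witness box `κ⁻¹(S₁²)` are ★ κ-comp (K2) (`G̃ = hypGram(κx)`) + E-det ball calculus — supplied by the caller.
[Kudla1994, §3] [Weil1964, n° 13] [MoeglinVignerasWaldspurger1987, Chap. 2 II.6] [Shimura1997, §13.2].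
HONEST LABEL.  Count-neutral helper; `HC_CM` is proved only modulo the 7 printed citations (2 remaining named inputs: hLiu418 = `stmt-HodgeConjecture-24832`,
h413 = `stmt-HodgeConjecture-24833`) until rung 0 closes.

## References
* [Kudla1994] S. S. Kudla, Israel J. Math. 87 (1994), §3.
* [Weil1964] A. Weil, Acta Math. 111 (1964), n° 13.
* [MoeglinVignerasWaldspurger1987] C. Mœglin, M.-F. Vignéras, J.-L. Waldspurger, LNM 1291 (1987), Chap. 2 II.6.
* [Shimura1997] G. Shimura, CBMS 93 (1997), §13.2.
-/

set_option autoImplicit false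
set_option linter.dupNamespace false -- the mandated namespace repeats `HodgeConjecture.HodgeConjecture`

noncomputable section

open NumberField IsDedekindDomain Matrix
open Literature.RepresentationTheory.HeisenbergGroup Literature.RepresentationTheory.HeisenbergGroup.SymplecticMatrix
open Literature.NumberTheory.Automorphic Literature.NumberTheory.Automorphic.UnitaryGroup Literature.NumberTheory.Weil1964
open Literature.NumberTheory.Automorphic.UnitaryGroup.QuadraticCoordinates
open Literature.NumberTheory.GaloisRepresentations Literature.NumberTheory.GaloisRepresentations.IsNonarchimedeanLocalField
open Literature.NumberTheory.GelbartRogawski1991.AdaptedBlocks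
open Literature.NumberTheory.GelbartRogawski1991 Literature.NumberTheory.GelbartRogawski1991.GRConstruction
open Literature.NumberTheory.GelbartRogawski1991.UnitaryDualPair Literature.NumberTheory.GelbartRogawski1991.UnitaryDualPair.LocalSplitting
open Literature.NumberTheory.K2Lit.SiegelDoubled
open Summit.HodgeConjecture.HodgeConjecture.Cruxes.HLiu418.K2LiuLocalSWSectionDefs
open Summit.HodgeConjecture.HodgeConjecture.Cruxes.HLiu418.K2LiuLocalSWTensorAdaptedBlocks
open scoped Kronecker

namespace Summit.HodgeConjecture.HodgeConjecture.Cruxes.HLiu418.K2LiuWitnessPhaseOnBox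

open K2LiuSiegelUnipotentPairingGram K2LiuWitnessPhaseBound

variable (L : Type) [Field L] [NumberField L] [IsCMField L]
variable {N M n : ℕ} (e : Fin N × Fin M ≃ Fin n)
  (dV : Fin N → L) (hdV : ∀ i, IsCMField.complexConj L (dV i) = dV i)
  (dW : Fin M → L) (hdW : ∀ i, IsCMField.complexConj L (dW i) = dW i)
variable {M₂ M' n' : ℕ} (eW : Fin M × Fin M₂ ≃ Fin M') (e' : Fin N × Fin M' ≃ Fin n')
  (dV' : Fin M₂ → L) (hdV' : ∀ k, IsCMField.complexConj L (dV' k) = dV' k)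
variable (v : HeightOneSpectrum (𝓞 (Fp L))) {π : v.adicCompletion (Fp L)} (hπ : Valued.v π = WithZero.exp (-1 : ℤ))

include hπ in
/-- **THE PHASE ON A BOX**: for small skew `t` with `H_t = δ̂•(𝕋₀ t) ∈ ball_a` and `x` whose frame Gram `G̃(x)` (★ (T3a)) is hermitian in `ball_b`, the Rao phase of the big
unipotent `ι⊗(n(t))` at `x` satisfies `½⟨x, c x⟩ ∈ 𝔭_v^{a + b − v(d)}` (`‖δ²‖_v = q^{−v(d)}`) — the `hphase` letter of (W1-a) with `K := {x ∣ G̃(x) ∈ ball_b}`.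
[cite: Kudla1994, §3] [cite: Weil1964, n° 13] [cite: MoeglinVignerasWaldspurger1987, Chap. 2 II.6] -/
theorem halfForm_mem_primePowBall_of_boxes [Invertible (2 : v.adicCompletion (Fp L))] {a b vd : ℤ}
    (hd : normAbs (v.adicCompletion (Fp L)) ((imagUnitSq L : Fp L) : v.adicCompletion (Fp L)) = (residueFieldCard (v.adicCompletion (Fp L)) : NNReal)⁻¹ ^ vd)
    (t : Matrix (Fin n) (Fin n) (LocalRing L v))
    (ht : (t.map (conjLocal L (IsCMField.complexConj L) v))ᵀ * gramS (Fp L) L v n (gramR L e dV hdV dW hdW) +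
      gramS (Fp L) L v n (gramR L e dV hdV dW hdW) * t = 0)
    (htbox : ∀ i j (w : PlacesOver L v), Valued.v ((algebraMap L (LocalRing L v) (imagUnit L) • (gramS (Fp L) L v n (gramR L e dV hdV dW hdW) * t)) i j w) ≤
      Valued.v (toPlace v w π) ^ a)
    (E' : LocalSp (Fp L) (n' + n') (gramD (Fp L) n' (gramR L e' dV hdV (tensorFrame L dW eW dV') (tensorFrame_real L dW hdW eW dV' hdV'))) v)
    (x : Fin (n' + n') → v.adicCompletion (Fp L))
    (hGherm : ((Matrix.of fun j i => ∑ k, ∑ l,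
            halfDiff ((eD (Fp L) L (IsCMField.complexConj L) (complexConj_imagUnit L) (imagUnit_ne_zero L) (imagUnit_mul_self L) v n').symm
                (toLin (Fp L) v E'⁻¹ (x, 0))) (epsV e eW e' (j, l)) *
              gramS (Fp L) L v M₂ (realDiagonal L dV' hdV') k l *
              conjLocal L (IsCMField.complexConj L) v
                (halfDiff ((eD (Fp L) L (IsCMField.complexConj L) (complexConj_imagUnit L) (imagUnit_ne_zero L) (imagUnit_mul_self L) v n').symm
                  (toLin (Fp L) v E'⁻¹ (x, 0))) (epsV e eW e' (i, k)))).map (conjLocal L (IsCMField.complexConj L) v))ᵀ =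
        Matrix.of fun j i => ∑ k, ∑ l,
            halfDiff ((eD (Fp L) L (IsCMField.complexConj L) (complexConj_imagUnit L) (imagUnit_ne_zero L) (imagUnit_mul_self L) v n').symm
                (toLin (Fp L) v E'⁻¹ (x, 0))) (epsV e eW e' (j, l)) *
              gramS (Fp L) L v M₂ (realDiagonal L dV' hdV') k l *
              conjLocal L (IsCMField.complexConj L) v
                (halfDiff ((eD (Fp L) L (IsCMField.complexConj L) (complexConj_imagUnit L) (imagUnit_ne_zero L) (imagUnit_mul_self L) v n').symm
                  (toLin (Fp L) v E'⁻¹ (x, 0))) (epsV e eW e' (i, k))))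
    (hGbox : ∀ j i (w : PlacesOver L v), Valued.v ((Matrix.of fun j i => ∑ k, ∑ l,
            halfDiff ((eD (Fp L) L (IsCMField.complexConj L) (complexConj_imagUnit L) (imagUnit_ne_zero L) (imagUnit_mul_self L) v n').symm
                (toLin (Fp L) v E'⁻¹ (x, 0))) (epsV e eW e' (j, l)) *
              gramS (Fp L) L v M₂ (realDiagonal L dV' hdV') k l *
              conjLocal L (IsCMField.complexConj L) v
                (halfDiff ((eD (Fp L) L (IsCMField.complexConj L) (complexConj_imagUnit L) (imagUnit_ne_zero L) (imagUnit_mul_self L) v n').symm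
                  (toLin (Fp L) v E'⁻¹ (x, 0))) (epsV e eW e' (i, k)))) j i w) ≤ Valued.v (toPlace v w π) ^ b) :
    halfForm (Matrix.mulVecLin (cOfFix (localGram (Fp L) (n' + n')
        (gramD (Fp L) n' (gramR L e' dV hdV (tensorFrame L dW eW dV') (tensorFrame_real L dW hdW eW dV' hdV'))) v)
        (E' * iotaD (Fp L) L (IsCMField.complexConj L) (complexConj_imagUnit L) (imagUnit_ne_zero L) (imagUnit_mul_self L) v n'
            (gramR_isSymm L e' dV hdV (tensorFrame L dW eW dV') (tensorFrame_real L dW hdW eW dV' hdV'))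
            (hermD_eq_map_gramD L e' dV hdV (tensorFrame L dW eW dV') (tensorFrame_real L dW hdW eW dV' hdV'))
            (tensorEmbLoc L e dV hdV dW hdW eW e' dV' hdV' v
              (nElem (Fp L) L (IsCMField.complexConj L) v n (T₀ := gramR L e dV hdV dW hdW) (hermD_eq_map_gramD L e dV hdV dW hdW) t ht)) * E'⁻¹))) x ∈
      primePowBall (v.adicCompletion (Fp L)) (a + b - vd) := by
  haveI : Algebra.IsQuadraticExtension (Fp L) L := IsCMField.isQuadraticExtension L
  rw [halfForm_apply, Matrix.mulVecLin_apply, dotProduct_cOfFix_tensorEmbLoc_nElem_eq_im_trace L e dV hdV dW hdW eW e' dV' hdV' v t ht E' x,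
    ← mul_mem_primePowBall_iff hd]
  exact d_mul_half_pairing_mem_primePowBall (Fp L) L (IsCMField.complexConj L) (complexConj_imagUnit L) (imagUnit_ne_zero L) (imagUnit_mul_self L) v hπ n
    (gramR_isSymm L e dV hdV dW hdW) t ht htbox hGherm hGbox rfl

end Summit.HodgeConjecture.HodgeConjecture.Cruxes.HLiu418.K2LiuWitnessPhaseOnBox

end
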